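import Summits.QuantumFields.BalabanUV.T4Continuum.Support.DirichletScalarTower
import Summits.QuantumFields.BalabanUV.Beta.GAN24.DirichletBoxTwoLevel

/-!
# T⁴ programme, spine node NE2 (U1a), sub-row Δ1 «NE2⁰-Dirichlet» (T4-DAG `T4-U1a.S-NE2-D1-DIRICHLET°`) — THE Ω-RESTRICTED SCALAR FREE
# TOWER ON A BOX OF UNIT BLOCKS IS UNCONDITIONAL: road P2's Dirichlet-box two-level law (`DirichletBoxTwoLevel.injected_le_box`)
# DISCHARGES the injected binder `hinjS` of `Support/DirichletScalarTower` at the torus rate `L^{−k}`, so [B9] (3.24)'s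
# `G′ = (Ω₀Δ′_aΩ₀)⁻¹` at `U = 1` obeys ALL the `FreeTowerLaws` and its unit-lattice images CONVERGE at rate `L⁻¹` — NO displayed binder

Twelfth generation of the NE2 prover lineage P1 of the cell `pub-balaban` (row NE2 owner), file 4 (owner item O12-d; the «≤ 40-l. adapter»
that unit b2b-balaban-gan24-p2 gen 22 handed to the row owner with its END, journal 2026-08-20 l.≈15008: «your `hinj` has a scalar-carrier
THEOREM on boxes: `DirichletBoxTwoLevel.injected_le_box` … adapter to `freeTowerLaws_dirichlet_scalar_of_injected`-shape along `lev L k` —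
yours or mine»).  ROAD P2's END (supplier item «Δ1-BOX-SCALAR» under this sub-row, 9 modules `Beta/GAN24/DirichletBox*`, Plancherel-free):
for every COORDINATE BOX `S` of unit blocks (`IsCoordBox M S`: any product of coordinate sets of the unit torus — boxes, slabs, wrapping or
not), every `d`, `a′ > 0`, `1 ≤ N`:
`‖(DOm (R·N) M a′ (refineR N R M (blockReg N M S)))⁻¹·JOm N R M (blockReg N M S) − JOm N R M (blockReg N M S)·(DOm N M a′ (blockReg N M S))⁻¹‖
≤ Cbox d R a′ / N`, `Cbox = (2 + 8√(2R))·(γ′⁻¹ + 2(1 + (a′γ′⁻¹)²))`.  THIS FILE runs it up the tower `n_k = L^k`: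

 * §1 RE-SPELLING A REGION (generic): for pointwise-equivalent predicates `p ↔ q` the compressed blocks along `q` are the blocks along `p`
   re-indexed by `Equiv.subtypeEquivRight` (`toBlock_eq_submatrix`, `rfl`), re-indexing along equivalences does not increase the operator
   norm (`opNorm_submatrix_le`), refinement respects equivalence (`refineR_congr`), hence **`norm_defect_le_of_iff`**: the two-level defect
   `‖(D′^{Ω′})⁻¹J^Ω − J^Ω(D^Ω)⁻¹‖` does not see the spelling of `Ω`, and **`injected_le_of_iff_blockReg`**: road P2's END holds for every
   predicate pointwise equivalent to `blockReg N M S`.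
 * §2 THE TOWER OF A BOX: the region tower generated by `Ω₀ = blockReg n₀ M S` (`n₀ = lev L 0 = 1`) IS, at every level, the block region
   `blockReg n_k M S` up to spelling — **`regS_blockReg_iff`** (induction on `k` through road P2's `refineR_blockReg_iff`: `par⁻¹(blockReg_N S) =
   blockReg_{RN} S` pointwise); hence **`injected_le_box_lev`**: `hinjS` HOLDS with `e₁ k = Cbox d L a′·L^{−k}`.
 * §3 THE ENDS, NO DISPLAYED BINDER: **`freeTowerLaws_dirichletScalar_box (hd : 0 < d) (ha′ : 0 < a′) (hS : IsCoordBox M S)`** —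
   `FreeTowerLaws (DsR (blockReg n₀ S)) (QsR …) (JsR …) 0 L^d (2d√(γ′⁻¹)·L^{−k}) (Cbox·L^{−k}) 0`; **`towerLimitRate_dirichletScalar_box (hL : 2 ≤ L)`**
   — the Ω-restricted unit-lattice scalar free covariances `L^{dk}·QsR^{(k)}(DsR k)⁻¹QsR^{(k)ᴴ}` CONVERGE at the torus rate `L⁻¹` with constant
   `Cpert 0 (2d√(γ′⁻¹)) Cbox 0 0 0`; and **`towerLimitRate_dirichletScalar_box_perturbed`** — the resolvent route over a box for any compressed
   perturbation family with `PerturbationLaws … κ (k ↦ C₂L^{−k})`, `‖t‖κ < 1`.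

WHAT THIS CLOSES AND WHAT IT DOES NOT (honest).  CLOSED (kernel, no binder): the `U = 1` SCALAR Dirichlet free tower of [B9] (3.24) on ONE
box-shaped region with ONE averaging scale — the first Ω-restricted two-level tower law in the tree that displays nothing.  NOT closed:
general unions of unit cubes (re-entrant edges: road P2's law is conditional there on one `DiscreteH2` inequality; the numerical census
Δ1-INJ sees the rate `L^{−k}` nevertheless); the VECTOR tower (`DirichletFreeTower`'s `hinj`: Bałaban's `Δ_a` with the gauge term — and
the [B9]-faithful one needs the REGION gauge projection (3.25)–(3.26), `Support/RegionGaugeProjection`, located delta G-ne2p1-g12-1); the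
multi-region `{Ω_j, a_j}` bookkeeping of (3.24); anything at `U ≠ 1`.

HONEST FRAMING (T4-DAG p. 1).  `U = 1`; SCALAR layer; ONE box region, ONE averaging scale; finite torus; linear layer; operator norm;
statements, pairing and constants OURS ([folklore] over landed modules; `[cite:]` tags locate SHAPES); «not in print; our proof» — [B9]
prints only the η-uniform bounds (3.42) for these operators; NE2 (U1a) NOT proved; spine 0/9 unchanged; NOT infinite volume, NOT a mass
gap, NOT the Clay problem, NOT summit progress.  HONEST DEPENDENCY: continuum YM on T⁴ ⇐ BetaPertH ∧ nine spine estimates (0/9 proved);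
BetaPertH ⇐ (D1) ∧ (D4) ∧ CAP+tail; G-an2-4 gates asym, D1 and NE2/3/4.  No `sorry`.
-/

noncomputable section

open scoped BigOperators ComplexConjugate Matrix Matrix.Norms.L2Operator
open Filter Topology

namespace Summit.QuantumFields.BalabanUV.T4Continuum.DirichletScalarTowerBox

open Literature.MathematicalPhysics.QuantumFieldTheory.Balaban1983to89.B5Prop11Plancherel (Tor fine)
open Literature.MathematicalPhysics.QuantumFieldTheory.Balaban1983to89.B5Prop11Lower (nsq nsq_nonneg)
open Literature.MathematicalPhysics.QuantumFieldTheory.Balaban1983to89.B5G183RateUnitTower (lev lev_neZero)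
open Summit.QuantumFields.BalabanUV.T4Continuum
open Summit.QuantumFields.BalabanUV.T4Continuum.CovariantAveragingTower (TowerLimitRate)
open Summit.QuantumFields.BalabanUV.T4Continuum.BalabanAveragedTowerUnit (one_le_lev' cast_lev')
open Summit.QuantumFields.BalabanUV.T4Continuum.BalabanAveragedTowerModes (par)
open Summit.QuantumFields.BalabanUV.T4Continuum.BalabanBlockPoincare (nsq_mulVec_le_rect)
open Summit.QuantumFields.BalabanUV.T4Continuum.BackgroundResolventTower
open Summit.QuantumFields.BalabanUV.T4Continuum.ScalarAveragedPropagator (gammaPs opNorm_le_of_nsq_le_rect)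
open Summit.QuantumFields.BalabanUV.T4Continuum.DirichletScalarTower
open Summit.QuantumFields.BalabanUV.Beta.GAN24.DirichletBoxCompression (DOm JOm refineR)
open Summit.QuantumFields.BalabanUV.Beta.GAN24.DirichletBoxTrace (blockReg)
open Summit.QuantumFields.BalabanUV.Beta.GAN24.DirichletBoxTwoLevelCore (refineR_blockReg_iff)
open Summit.QuantumFields.BalabanUV.Beta.GAN24.DirichletBoxTwoLevel (IsCoordBox Cbox cDir_nonneg Lam_nonneg injected_le_box)

/-! ## §1 Re-spelling a region by an equivalent predicate -/

section Transport

variable {m n : Type*} [Fintype m] [DecidableEq m] [Fintype n] [DecidableEq n]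

/-- the identification of the subtypes of two pointwise-equivalent predicates (from the `q`-spelling to the `p`-spelling). [folklore] -/
def eqv {p q : m → Prop} (h : ∀ x, p x ↔ q x) : {x // q x} ≃ {x // p x} := Equiv.subtypeEquivRight fun x => (h x).symm

omit [Fintype m] [DecidableEq m] [Fintype n] [DecidableEq n] in
/-- a block along the `q`-spellings is the corresponding block along the `p`-spellings, re-indexed (definitional). [folklore] -/
theorem toBlock_eq_submatrix {p q : m → Prop} {p' q' : n → Prop} [DecidablePred p] [DecidablePred q] [DecidablePred p']
    [DecidablePred q'] (h : ∀ x, p x ↔ q x) (h' : ∀ y, p' y ↔ q' y) (X : Matrix m n ℂ) :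
    X.toBlock q q' = (X.toBlock p p').submatrix (eqv h) (eqv h') := rfl

omit [DecidableEq m] [DecidableEq n] in
/-- `Σ|w|²` is invariant under re-indexing by an equivalence. [folklore] -/
theorem nsq_comp_equiv {α β : Type*} [Fintype α] [Fintype β] (e : α ≃ β) (w : β → ℂ) : nsq (w ∘ e) = nsq w := by
  unfold nsq
  exact e.sum_comp (fun b => ‖w b‖ ^ 2)

/-- re-indexing a rectangular matrix along equivalences does not increase its operator norm. [folklore] -/
theorem opNorm_submatrix_le {α β γ δ : Type*} [Fintype α] [DecidableEq α] [Fintype β] [DecidableEq β] [Fintype γ] [DecidableEq γ]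
    [Fintype δ] [DecidableEq δ] (A : Matrix α β ℂ) (e₁ : γ ≃ α) (e₂ : δ ≃ β) : ‖A.submatrix e₁ e₂‖ ≤ ‖A‖ := by
  refine opNorm_le_of_nsq_le_rect _ (norm_nonneg A) fun v => ?_
  rw [Matrix.submatrix_mulVec_equiv, nsq_comp_equiv, ← nsq_comp_equiv e₂.symm v]
  exact nsq_mulVec_le_rect A _

end Transport

section Defect

variable {d : ℕ} (N R : ℕ) [NeZero N] [NeZero R] (M : Fin d → ℕ) [hM : ∀ μ, NeZero (M μ)] (a' : ℝ)

omit [NeZero N] [NeZero R] hM in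
/-- refinement respects pointwise equivalence of predicates. [folklore] -/
theorem refineR_congr {p q : Tor (fine N M) → Prop} (h : ∀ x, p x ↔ q x) :
    ∀ x, refineR N R M p x ↔ refineR N R M q x := fun x => h (par N R M x)

/-- **THE TWO-LEVEL DEFECT DOES NOT SEE THE SPELLING OF THE REGION**: for pointwise-equivalent predicates `p`, `q` the defect along
`q` is the defect along `p` re-indexed, so its norm is at most (indeed equal to) the norm along `p`. [folklore] -/
theorem norm_defect_le_of_iff {p q : Tor (fine N M) → Prop} [DecidablePred p] [DecidablePred q] (h : ∀ x, p x ↔ q x) :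
    ‖(DOm (R * N) M a' (refineR N R M q))⁻¹ * JOm N R M q - JOm N R M q * (DOm N M a' q)⁻¹‖
      ≤ ‖(DOm (R * N) M a' (refineR N R M p))⁻¹ * JOm N R M p - JOm N R M p * (DOm N M a' p)⁻¹‖ := by
  have h' : ∀ x, refineR N R M p x ↔ refineR N R M q x := refineR_congr N R M h
  have eD : DOm N M a' q = (DOm N M a' p).submatrix (eqv h) (eqv h) := toBlock_eq_submatrix h h _
  have eD' : DOm (R * N) M a' (refineR N R M q) = (DOm (R * N) M a' (refineR N R M p)).submatrix (eqv h') (eqv h') :=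
    toBlock_eq_submatrix h' h' _
  have eJ : JOm N R M q = (JOm N R M p).submatrix (eqv h') (eqv h) := toBlock_eq_submatrix h' h _
  rw [eD, eD', eJ, Matrix.inv_submatrix_equiv, Matrix.inv_submatrix_equiv, Matrix.submatrix_mul_equiv,
    Matrix.submatrix_mul_equiv]
  have e : ((DOm (R * N) M a' (refineR N R M p))⁻¹ * JOm N R M p).submatrix (eqv h') (eqv h)
      - (JOm N R M p * (DOm N M a' p)⁻¹).submatrix (eqv h') (eqv h)
      = ((DOm (R * N) M a' (refineR N R M p))⁻¹ * JOm N R M p - JOm N R M p * (DOm N M a' p)⁻¹).submatrix (eqv h') (eqv h) := rfl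
  rw [e]
  exact opNorm_submatrix_le _ _ _

/-- **ROAD P2's BOX END IN ANY SPELLING**: for a coordinate box `S` and every predicate `q` pointwise equivalent to `blockReg N M S`,
`‖(D′^{par⁻¹q})⁻¹·J^q − J^q·(D^q)⁻¹‖ ≤ Cbox d R a′ / N`. [folklore] -/
theorem injected_le_of_iff_blockReg {S : Tor M → Prop} [DecidablePred S] (hS : IsCoordBox M S) (hN : 1 ≤ N) (ha' : 0 < a')
    {q : Tor (fine N M) → Prop} [DecidablePred q] (h : ∀ x, blockReg N M S x ↔ q x) :
    ‖(DOm (R * N) M a' (refineR N R M q))⁻¹ * JOm N R M q - JOm N R M q * (DOm N M a' q)⁻¹‖ ≤ Cbox d R a' / N :=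
  (norm_defect_le_of_iff N R M a' h).trans (injected_le_box N R M S hS hN ha')

end Defect

/-! ## §2 The tower of a box: every level of the region tower generated by a block region is the block region -/

variable {d : ℕ} (L : ℕ) [NeZero L] (M : Fin d → ℕ) [hM : ∀ μ, NeZero (M μ)] (a' : ℝ) (S : Tor M → Prop) [DecidablePred S]

omit [DecidablePred S] in
/-- **`regS (blockReg n₀ S) k ↔ blockReg n_k S`** pointwise, for every `k` (`n₀ = lev L 0 = 1`): the tower generated by the unit-lattice
block region of `S` IS the block region of `S` at every spacing, up to spelling (`par⁻¹(blockReg_N S) = blockReg_{RN} S`). [folklore] -/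
theorem regS_blockReg_iff : ∀ (k : ℕ) (x : Tor (fine (lev L k) M)), regS L M (blockReg (lev L 0) M S) k x ↔ blockReg (lev L k) M S x
  | 0, _ => Iff.rfl
  | k + 1, x => by
      rw [regS_succ, regS_blockReg_iff k]
      exact refineR_blockReg_iff (lev L k) L M S x

/-- **`hinjS` HOLDS ON A BOX, at the torus rate**: `‖(DsR (k+1))⁻¹·JsR k − JsR k·(DsR k)⁻¹‖ ≤ Cbox d L a′·L^{−k}` for the region tower
generated by the block region of a coordinate box `S`. [folklore] -/
theorem injected_le_box_lev (hS : IsCoordBox M S) (ha' : 0 < a') (k : ℕ) :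
    ‖(DsR L M a' (blockReg (lev L 0) M S) (k + 1))⁻¹ * JsR L M (blockReg (lev L 0) M S) k
        - JsR L M (blockReg (lev L 0) M S) k * (DsR L M a' (blockReg (lev L 0) M S) k)⁻¹‖ ≤ Cbox d L a' * ((L : ℝ)⁻¹) ^ k := by
  have h := injected_le_of_iff_blockReg (lev L k) L M a' hS (one_le_lev' L k) ha'
    (fun x => (regS_blockReg_iff L M S k x).symm)
  rw [cast_lev'] at h
  rw [inv_pow, ← div_eq_mul_inv]
  exact h

/-! ## §3 The ENDs: the scalar Dirichlet free tower of a box, no displayed binder -/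

/-- **THE Ω-RESTRICTED SCALAR FREE TOWER LAWS ON A BOX — UNCONDITIONAL** (`U = 1`, `d ≥ 1`, `a′ > 0`, `S` a coordinate box of unit
blocks): every field of `FreeTowerLaws` for [B9] (3.24)'s `Ω₀Δ′_aΩ₀` at `U = 1` along `n_k = L^k` is a THEOREM — invertibility,
`‖QsR‖² ≤ L^{−d}`, `‖JsR‖ ≤ 1`, exact pairing, complement law `2d√(γ′⁻¹)·L^{−k}`, AND the injected law `Cbox·L^{−k}` (road P2).  Nothing is
displayed. [cite: Balaban1985BackgroundPropagators, p.394 (3.24), Thm 3.1 (3.42) p.397 (η-uniform kind only; the rate is ours)] [folklore] -/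
theorem freeTowerLaws_dirichletScalar_box (hd : 0 < d) (ha' : 0 < a') (hS : IsCoordBox M S) :
    FreeTowerLaws (DsR L M a' (blockReg (lev L 0) M S)) (QsR L M (blockReg (lev L 0) M S)) (JsR L M (blockReg (lev L 0) M S))
      (fun _ => 0) ((L : ℝ) ^ d) (fun k => 2 * d * Real.sqrt ((gammaPs d a')⁻¹) * ((L : ℝ)⁻¹) ^ k)
      (fun k => Cbox d L a' * ((L : ℝ)⁻¹) ^ k) (fun _ => 0) :=
  freeTowerLaws_dirichletScalar_of_injected L M a' (blockReg (lev L 0) M S) hd ha' (injected_le_box_lev L M a' S hS ha')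

/-- **THE Ω-RESTRICTED UNIT-LATTICE SCALAR FREE COVARIANCES OF A BOX CONVERGE AT THE TORUS RATE `L⁻¹`** (`L ≥ 2`, `d ≥ 1`, `a′ > 0`,
`S` a coordinate box): `TowerLimitRate (QsR (blockReg n₀ S)) L^d (k ↦ (DsR k)⁻¹) (Cpert 0 (2d√(γ′⁻¹)) (Cbox d L a′) 0 0 0) L⁻¹` —
UNCONDITIONAL: King's scalar η-rate (Lemma 4.5 shape) survives the Dirichlet restriction to a box. [cite: King1986, Lemma 4.5 (4.38) p.674
(shape); Balaban1985BackgroundPropagators, p.394 (3.24)] [folklore] -/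
theorem towerLimitRate_dirichletScalar_box (hL : 2 ≤ L) (hd : 0 < d) (ha' : 0 < a') (hS : IsCoordBox M S) :
    TowerLimitRate (QsR L M (blockReg (lev L 0) M S)) ((L : ℝ) ^ d) (fun k => (DsR L M a' (blockReg (lev L 0) M S) k)⁻¹)
      (Cpert 0 (2 * d * Real.sqrt ((gammaPs d a')⁻¹)) (Cbox d L a') 0 0 0) ((L : ℝ)⁻¹) :=
  towerLimitRate_dirichletScalar_of_injected L M a' (blockReg (lev L 0) M S) hd ha' le_rfl (inv_lt_one_of_one_lt₀ (by exact_mod_cast (lt_of_lt_of_le one_lt_two hL : 1 < L)))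
    (injected_le_box_lev L M a' S hS ha')

/-- **THE RESOLVENT ROUTE OVER A BOX**: for every compressed perturbation family `P` of the box tower with
`PerturbationLaws (DsR …) P (JsR …) κ (k ↦ C₂L^{−k})` and every `‖t‖κ < 1`, the Ω-restricted perturbed scalar covariances converge at the
rate `L⁻¹` — the free-tower input is now a THEOREM, only the perturbation laws are displayed. [folklore] -/
theorem towerLimitRate_dirichletScalar_box_perturbed (hL : 2 ≤ L) (hd : 0 < d) (ha' : 0 < a') (hS : IsCoordBox M S)
    {P : (k : ℕ) → Matrix (sidx L M (blockReg (lev L 0) M S) k) (sidx L M (blockReg (lev L 0) M S) k) ℂ} {κ C₂ : ℝ}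
    (hpert : PerturbationLaws (DsR L M a' (blockReg (lev L 0) M S)) P (JsR L M (blockReg (lev L 0) M S)) κ
      (fun k => C₂ * ((L : ℝ)⁻¹) ^ k)) {t : ℂ} (ht : ‖t‖ * κ < 1) :
    TowerLimitRate (QsR L M (blockReg (lev L 0) M S)) ((L : ℝ) ^ d) (fun k => (DsR L M a' (blockReg (lev L 0) M S) k + t • P k)⁻¹)
      (Cpert κ (2 * d * Real.sqrt ((gammaPs d a')⁻¹)) (Cbox d L a') C₂ 0 t) ((L : ℝ)⁻¹) :=
  towerLimitRate_dirichletScalar_perturbed L M a' (blockReg (lev L 0) M S) hd ha' le_rfl (inv_lt_one_of_one_lt₀ (by exact_mod_cast (lt_of_lt_of_le one_lt_two hL : 1 < L)))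
    (injected_le_box_lev L M a' S hS ha') hpert ht

/-- the box constant is nonnegative (for consumers' bookkeeping). [folklore] -/
theorem Cbox_nonneg (R : ℕ) : 0 ≤ Cbox d R a' := mul_nonneg (cDir_nonneg R) (Lam_nonneg (d := d) a')

end Summit.QuantumFields.BalabanUV.T4Continuum.DirichletScalarTowerBox

end
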